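import Mathlib
import HarnessLib
import Summits.HubbardSuperconductivity.HubbardSuperconductivity.Theorems.KLProgrammeKLRegimeFramePosKernelL1
import Summits.HubbardSuperconductivity.HubbardSuperconductivity.Theorems.KLProgrammeKLRegimeSplitPredicates

/-!
# K3 ENGINE child (stmt-HubbardSuperconductivity-19855), stub `stub_engine_scale0`, input (O-θ): the intrinsic `ℓ¹` size
# `κ_K(L) = Σ_z ‖Ǩ_L(z)‖` of an ADMISSIBLE frame is `O(|U|)` — uniformly in the number of scales `N`, in `β` and in `L`

Cell gate-hubbard-kl, seat p3 (g6).  Both scale-`0` clauses that run on the determinant-bounded step — (E1-v4)₀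
(`klAnisoLegKernelNorm_zero_le_of_gridStep(_l1)`, k3c2-p1) and the values clause (`norm_klPairAmplitude_zero_sub_le_of_gridStep`, p3 g6) —
read the degree-`2` pinned size of the grid counterterm `(β/N)·κ_K`, `κ_K ≥ Σ_z ‖framePosKernel L K z‖`, LINEARLY in their bound; to
compare with the package tolerances (`CE²·Klam·|U|`, resp. `O(U²)` after the factor `θ = O(U)`) one needs `κ_K = O(|U|)` for EVERY
`U ∈ (0, U₀]` at fixed regime constant `c`.  The frame class `FrameOK R U N μ K` writes `K = Σ_{n ≤ N} Kp n` with
`‖Dʲ(Kp n)‖ ≤ Gfr j · uPow j U · 4^{(j-2)n}`; a GLOBAL second-derivative bound `‖D²K‖ ≤ (N+1)·Gfr2·U²` is of order `c` (`N ≍ c/(U² ln 4)`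
scales), not `U` (`…EngineFramePosKernelBound.sum_norm_framePosKernel_le_of_frameOK`, k3c2-p1: `… + (π²/4)·Gfr2·U²·(N+1)`).  Here the
bound is taken PIECE BY PIECE with k3c2-p3's intrinsic `√(A·D)`-law (`TorusFourierL2.sum_norm_framePosKernel_le_of_bounds`, p483373:
`Σ_z ‖Ǩ_L(z)‖ ≤ 256·√(24π²·A·D + 64·A²)` from `|K| ≤ A`, `‖D²K‖ ≤ D`), which IS scale-aware: piece `n` has `A_n = Gfr0·|U|·16^{-n}`,
`D_n = Gfr2·U²`, so `√(A_n D_n) ∝ |U|^{3/2}·4^{-n}` and `A_n ∝ |U|·16^{-n}` are summable over `n`: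

* `framePosKernel_eq_sum_of_eval` — `Ǩ_L` is additive along any finite decomposition of `K.eval` (it reads `K` only through `K.eval` at the
  lattice momenta); `sum_norm_framePosKernel_le_of_eval`;
* `abs_frameShift_le_of_iteratedFDeriv_zero`, `norm_iteratedFDeriv_two_frameShift_le` — `frameShift A = −evalM A`;
* `sum_norm_framePosKernel_piece_le` — piece `n` of an admissible frame: `Σ_z ‖Ǩ_{Kp n}(z)‖ ≤ 256·(√(24π²(Gfr0+1)(Gfr2+1))·|U|√|U|·4^{-n} + 8(Gfr0+1)|U|·16^{-n})`
  (the `+1`'s make the `√(A·D)` data strictly positive for `U ≠ 0` without a sign hypothesis on `R`);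
* **`sum_norm_framePosKernel_le_of_frameOK_pieces`** — `Σ_z ‖Ǩ_L(z)‖ ≤ 256·((4/3)·√(24π²(Gfr0+1)(Gfr2+1))·|U|√|U| + (16/15)·8·(Gfr0+1)·|U|)`
  for every admissible frame, every `N`, every `L` (`R.WF`, `U ≠ 0`);
* `sum_norm_framePosKernel_le_linear_of_frameOK` — for `|U| ≤ 1`: `≤ 256·((4/3)·√(24π²(Gfr0+1)(Gfr2+1)) + (128/15)·(Gfr0+1))·|U|`.

Everything is proved; no definitions, no named facts, no sorry.  bears_on: R2d via K3 → ENGINE 19855 `stub_engine_scale0` ((E1-v4)₀ and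
the values clause, input (O-θ)).
-/

noncomputable section

namespace Summit.HubbardSuperconductivity.HubbardSuperconductivity.Theorems.EngineV8

set_option linter.dupNamespace false -- summit = problem name (single-conjunct summit), D-0017

open Real Finset Literature.MathematicalPhysics.QuantumLattice Literature.Probability.LatticeModels
open Summit.HubbardSuperconductivity.HubbardSuperconductivity.Theorems.KLRegimeSplit
open Summit.HubbardSuperconductivity.HubbardSuperconductivity.Theorems.DispersionFlow
open Summit.HubbardSuperconductivity.HubbardSuperconductivity.Theorems.TorusFourierL2
open scoped ComplexConjugate

/-! ## §1 `Ǩ_L` is additive along a decomposition of `K.eval` -/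

section Additive

variable {L : ℕ} [NeZero L]

/-- **`Ǩ_L` reads `K` only through `K.eval` at the lattice momenta, linearly**: if `K.eval = Σ_{n ∈ s} (Kp n).eval` pointwise, then
`framePosKernel L K z = Σ_{n ∈ s} framePosKernel L (Kp n) z`. -/
theorem framePosKernel_eq_sum_of_eval (K : TrigPolyC4v) (s : Finset ℕ) (Kp : ℕ → TrigPolyC4v)
    (h : ∀ p : Fin 2 → ℝ, K.eval p = ∑ n ∈ s, (Kp n).eval p) (z : TorusSite 2 L) :
    framePosKernel L K z = ∑ n ∈ s, framePosKernel L (Kp n) z := by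
  simp only [framePosKernel]
  rw [← mul_sum, sum_comm]
  congr 1
  refine sum_congr rfl fun q _ => ?_
  rw [h, Complex.ofReal_sum, sum_mul]

/-- Hence `Σ_z ‖Ǩ_L(z)‖ ≤ Σ_{n ∈ s} Σ_z ‖(Kp n)ˇ_L(z)‖`. -/
theorem sum_norm_framePosKernel_le_of_eval (K : TrigPolyC4v) (s : Finset ℕ) (Kp : ℕ → TrigPolyC4v)
    (h : ∀ p : Fin 2 → ℝ, K.eval p = ∑ n ∈ s, (Kp n).eval p) :
    ∑ z : TorusSite 2 L, ‖framePosKernel L K z‖ ≤ ∑ n ∈ s, ∑ z : TorusSite 2 L, ‖framePosKernel L (Kp n) z‖ := by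
  rw [sum_comm]
  exact sum_le_sum fun z _ => by rw [framePosKernel_eq_sum_of_eval K s Kp h z]; exact norm_sum_le _ _

end Additive

/-! ## §2 `frameShift A = −evalM A`: the hypotheses of the intrinsic bound from `iteratedFDeriv` data of `evalM` -/

/-- `frameShift A = −evalM A` as functions on `Momentum`. -/
theorem frameShift_eq_neg_evalM (A : TrigPolyC4v) : frameShift A = -evalM A := by
  funext q
  rfl

/-- `|frameShift A x| ≤ B` from the order-`0` clause `‖iteratedFDeriv ℝ 0 (evalM A) q‖ ≤ B`. -/
theorem abs_frameShift_le_of_iteratedFDeriv_zero (A : TrigPolyC4v) {B : ℝ} (h : ∀ q, ‖iteratedFDeriv ℝ 0 (evalM A) q‖ ≤ B)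
    (x : Momentum) : |frameShift A x| ≤ B := by
  have hx := h x
  rw [norm_iteratedFDeriv_zero, Real.norm_eq_abs] at hx
  rw [frameShift_eq_neg_evalM, Pi.neg_apply, abs_neg]
  exact hx

/-- `‖D²(frameShift A) x‖ ≤ B` from the order-`2` clause `‖iteratedFDeriv ℝ 2 (evalM A) q‖ ≤ B`. -/
theorem norm_iteratedFDeriv_two_frameShift_le (A : TrigPolyC4v) {B : ℝ} (h : ∀ q, ‖iteratedFDeriv ℝ 2 (evalM A) q‖ ≤ B)
    (x : Momentum) : ‖iteratedFDeriv ℝ 2 (frameShift A) x‖ ≤ B := by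
  rw [frameShift_eq_neg_evalM, iteratedFDeriv_neg_apply, norm_neg]
  exact h x

/-! ## §3 One frame piece -/

/-- `√(a + b) ≤ √a + √b` for `a, b ≥ 0`. -/
private theorem sqrt_add_le_sqrt_add_sqrt {a b : ℝ} (ha : 0 ≤ a) (hb : 0 ≤ b) :
    Real.sqrt (a + b) ≤ Real.sqrt a + Real.sqrt b := by
  rw [Real.sqrt_le_left (by positivity)]
  nlinarith [Real.sq_sqrt ha, Real.sq_sqrt hb, Real.sqrt_nonneg a, Real.sqrt_nonneg b]

/-- `4^{(0-2)·n} = (1/16)^n` (the order-`0` weight of `FrameOK`). -/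
theorem four_zpow_zero_sub_two_mul (n : ℕ) : (4 : ℝ) ^ ((((0 : ℕ) : ℤ) - 2) * (n : ℤ)) = (1 / 16 : ℝ) ^ n := by
  rw [Nat.cast_zero, zero_sub, zpow_mul, show (4 : ℝ) ^ (-2 : ℤ) = 1 / 16 by norm_num, zpow_natCast]

/-- `4^{(2-2)·n} = 1` (the order-`2` weight of `FrameOK`). -/
theorem four_zpow_two_sub_two_mul (n : ℕ) : (4 : ℝ) ^ ((((2 : ℕ) : ℤ) - 2) * (n : ℤ)) = 1 := by
  rw [Nat.cast_ofNat, sub_self, zero_mul, zpow_zero]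

/-- `√((1/16)^n) = (1/4)^n`. -/
theorem sqrt_one_div_sixteen_pow (n : ℕ) : Real.sqrt ((1 / 16 : ℝ) ^ n) = (1 / 4 : ℝ) ^ n := by
  rw [show (1 / 16 : ℝ) ^ n = ((1 / 4 : ℝ) ^ n) ^ 2 by rw [← pow_mul, mul_comm, pow_mul]; norm_num,
    Real.sqrt_sq (by positivity)]

/-- **One frame piece**: if `‖D⁰A‖ ≤ Gfr0·|U|·4^{-2n}` and `‖D²A‖ ≤ Gfr2·U²` everywhere (`Gfr0, Gfr2 ≥ 0`, `U ≠ 0`), then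
`Σ_z ‖Ǎ_L(z)‖ ≤ 256·(√(24π²(Gfr0+1)(Gfr2+1))·|U|√|U|·4^{-n} + 8·(Gfr0+1)·|U|·16^{-n})` — the intrinsic `√(A·D)` law with the piece's own data. -/
theorem sum_norm_framePosKernel_piece_le {L : ℕ} [NeZero L] (A : TrigPolyC4v) {G0 G2 U : ℝ} (hG0 : 0 ≤ G0) (hG2 : 0 ≤ G2) (hU : U ≠ 0)
    (n : ℕ) (h0 : ∀ q, ‖iteratedFDeriv ℝ 0 (evalM A) q‖ ≤ G0 * |U| * (1 / 16 : ℝ) ^ n)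
    (h2 : ∀ q, ‖iteratedFDeriv ℝ 2 (evalM A) q‖ ≤ G2 * U ^ 2) :
    ∑ z : TorusSite 2 L, ‖framePosKernel L A z‖ ≤
      256 * (Real.sqrt (24 * π ^ 2 * (G0 + 1) * (G2 + 1)) * (|U| * Real.sqrt |U|) * (1 / 4 : ℝ) ^ n +
        8 * (G0 + 1) * |U| * (1 / 16 : ℝ) ^ n) := by
  have hUa : 0 < |U| := abs_pos.2 hU
  have hU2 : 0 < U ^ 2 := by positivity
  -- strictly positive data dominating the piece's
  set Ap : ℝ := (G0 + 1) * |U| * (1 / 16 : ℝ) ^ n with hAp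
  set Dp : ℝ := (G2 + 1) * U ^ 2 with hDp
  have hAp0 : 0 < Ap := by positivity
  have hDp0 : 0 < Dp := by positivity
  have h0' : ∀ x, |frameShift A x| ≤ Ap := fun x =>
    (abs_frameShift_le_of_iteratedFDeriv_zero A h0 x).trans (by
      rw [hAp]; exact mul_le_mul_of_nonneg_right (mul_le_mul_of_nonneg_right (by linarith) hUa.le) (by positivity))
  have h2' : ∀ x, ‖iteratedFDeriv ℝ 2 (frameShift A) x‖ ≤ Dp := fun x =>
    (norm_iteratedFDeriv_two_frameShift_le A h2 x).trans (by rw [hDp]; exact mul_le_mul_of_nonneg_right (by linarith) hU2.le)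
  refine (sum_norm_framePosKernel_le_of_bounds (L := L) A hAp0 hDp0 h0' h2').trans ?_
  refine mul_le_mul_of_nonneg_left ?_ (by norm_num)
  -- `√(24π² Ap Dp + 64 Ap²) ≤ √(24π² Ap Dp) + 8 Ap`
  have hsplit := sqrt_add_le_sqrt_add_sqrt (a := 24 * π ^ 2 * Ap * Dp) (b := 64 * Ap ^ 2) (by positivity) (by positivity)
  refine hsplit.trans (le_of_eq ?_)
  have h64 : Real.sqrt (64 * Ap ^ 2) = 8 * Ap := by
    rw [show (64 : ℝ) * Ap ^ 2 = (8 * Ap) ^ 2 by ring, Real.sqrt_sq (by positivity)]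
  have hAD : 24 * π ^ 2 * Ap * Dp = (24 * π ^ 2 * (G0 + 1) * (G2 + 1)) * (|U| ^ 2 * |U|) * (1 / 16 : ℝ) ^ n := by
    rw [hAp, hDp, ← sq_abs U]; ring
  have hsq : Real.sqrt (24 * π ^ 2 * Ap * Dp) =
      Real.sqrt (24 * π ^ 2 * (G0 + 1) * (G2 + 1)) * (|U| * Real.sqrt |U|) * (1 / 4 : ℝ) ^ n := by
    have hX : 0 ≤ 24 * π ^ 2 * (G0 + 1) * (G2 + 1) := by positivity
    have hXU : 0 ≤ 24 * π ^ 2 * (G0 + 1) * (G2 + 1) * (|U| ^ 2 * |U|) := by positivity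
    rw [hAD, Real.sqrt_mul hXU ((1 / 16 : ℝ) ^ n), Real.sqrt_mul hX (|U| ^ 2 * |U|), Real.sqrt_mul (sq_nonneg |U|) |U|,
      Real.sqrt_sq hUa.le, sqrt_one_div_sixteen_pow]
  rw [hsq, h64, hAp]
  ring

/-! ## §4 The admissible frame: sum over the pieces -/

/-- **The intrinsic `ℓ¹` size of an admissible frame's position kernel is `O(|U|)`**: for `FrameOK R U N μ K` (`R.WF`, `U ≠ 0`) and every `L`,
`Σ_z ‖Ǩ_L(z)‖ ≤ 256·((4/3)·√(24π²(Gfr0+1)(Gfr2+1))·|U|√|U| + (16/15)·8·(Gfr0+1)·|U|)` — uniformly in the number of pieces `N + 1`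
(piece `n` costs `∝ 4^{-n}` and `∝ 16^{-n}`). -/
theorem sum_norm_framePosKernel_le_of_frameOK_pieces {L : ℕ} [NeZero L] {R : RenConsts} (hR : R.WF) {U : ℝ} (hU : U ≠ 0) {N : ℕ}
    {μ : ℝ} {K : TrigPolyC4v} (hK : FrameOK R U N μ K) :
    ∑ z : TorusSite 2 L, ‖framePosKernel L K z‖ ≤
      256 * ((4 / 3) * (Real.sqrt (24 * π ^ 2 * (R.Gfr 0 + 1) * (R.Gfr 2 + 1)) * (|U| * Real.sqrt |U|)) +
        (16 / 15) * (8 * (R.Gfr 0 + 1) * |U|)) := by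
  obtain ⟨-, Kp, heval, hpieces⟩ := hK
  have hG : ∀ j, 0 ≤ R.Gfr j := hR.2.2
  -- piece by piece
  have hpiece : ∀ n ∈ range (N + 1), ∑ z : TorusSite 2 L, ‖framePosKernel L (Kp n) z‖ ≤
      256 * (Real.sqrt (24 * π ^ 2 * (R.Gfr 0 + 1) * (R.Gfr 2 + 1)) * (|U| * Real.sqrt |U|) * (1 / 4 : ℝ) ^ n +
        8 * (R.Gfr 0 + 1) * |U| * (1 / 16 : ℝ) ^ n) := by
    intro n hn
    have hnN : n ≤ N := Nat.lt_succ_iff.1 (mem_range.1 hn)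
    refine sum_norm_framePosKernel_piece_le (Kp n) (hG 0) (hG 2) hU n (fun q => ?_) (fun q => ?_)
    · have h := hpieces n hnN 0 (by norm_num) q
      rwa [four_zpow_zero_sub_two_mul, uPow, if_pos rfl] at h
    · have h := hpieces n hnN 2 (by norm_num) q
      rwa [four_zpow_two_sub_two_mul, mul_one, uPow, if_neg (by norm_num)] at h
  refine (sum_norm_framePosKernel_le_of_eval K (range (N + 1)) Kp heval).trans ((sum_le_sum hpiece).trans ?_)
  -- the two geometric sums
  have hq : ∑ n ∈ range (N + 1), (1 / 4 : ℝ) ^ n ≤ 4 / 3 := by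
    have h := geom_sum_Ico_le_of_lt_one (m := 0) (n := N + 1) (x := (1 / 4 : ℝ)) (by norm_num) (by norm_num)
    rw [← Finset.range_eq_Ico, pow_zero] at h
    exact h.trans (by norm_num)
  have hs : ∑ n ∈ range (N + 1), (1 / 16 : ℝ) ^ n ≤ 16 / 15 := by
    have h := geom_sum_Ico_le_of_lt_one (m := 0) (n := N + 1) (x := (1 / 16 : ℝ)) (by norm_num) (by norm_num)
    rw [← Finset.range_eq_Ico, pow_zero] at h
    exact h.trans (by norm_num)
  have hC1 : 0 ≤ Real.sqrt (24 * π ^ 2 * (R.Gfr 0 + 1) * (R.Gfr 2 + 1)) * (|U| * Real.sqrt |U|) := by positivity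
  have hC2 : 0 ≤ 8 * (R.Gfr 0 + 1) * |U| := by have := hG 0; positivity
  rw [← mul_sum]
  refine mul_le_mul_of_nonneg_left ?_ (by norm_num)
  rw [sum_add_distrib, ← mul_sum, ← mul_sum]
  calc _ ≤ Real.sqrt (24 * π ^ 2 * (R.Gfr 0 + 1) * (R.Gfr 2 + 1)) * (|U| * Real.sqrt |U|) * (4 / 3) +
        8 * (R.Gfr 0 + 1) * |U| * (16 / 15) :=
        add_le_add (mul_le_mul_of_nonneg_left hq hC1) (mul_le_mul_of_nonneg_left hs hC2)
    _ = _ := by ring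

/-- **Linear form for `|U| ≤ 1`**: `Σ_z ‖Ǩ_L(z)‖ ≤ 256·((4/3)·√(24π²(Gfr0+1)(Gfr2+1)) + (128/15)·(Gfr0+1))·|U|` — the degree-`2` size of the
grid counterterm is `(β/N)` times an `O(|U|)` constant of the package `R` alone, for every admissible frame and every number of scales. -/
theorem sum_norm_framePosKernel_le_linear_of_frameOK {L : ℕ} [NeZero L] {R : RenConsts} (hR : R.WF) {U : ℝ} (hU : U ≠ 0)
    (hU1 : |U| ≤ 1) {N : ℕ} {μ : ℝ} {K : TrigPolyC4v} (hK : FrameOK R U N μ K) :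
    ∑ z : TorusSite 2 L, ‖framePosKernel L K z‖ ≤
      256 * ((4 / 3) * Real.sqrt (24 * π ^ 2 * (R.Gfr 0 + 1) * (R.Gfr 2 + 1)) + (128 / 15) * (R.Gfr 0 + 1)) * |U| := by
  have hG : ∀ j, 0 ≤ R.Gfr j := hR.2.2
  refine (sum_norm_framePosKernel_le_of_frameOK_pieces hR hU hK).trans ?_
  have hsU : Real.sqrt |U| ≤ 1 := by rw [Real.sqrt_le_one]; exact hU1
  have h1 : |U| * Real.sqrt |U| ≤ |U| := by
    have := mul_le_mul_of_nonneg_left hsU (abs_nonneg U); rwa [mul_one] at this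
  have hS : 0 ≤ Real.sqrt (24 * π ^ 2 * (R.Gfr 0 + 1) * (R.Gfr 2 + 1)) := Real.sqrt_nonneg _
  have hG0 : 0 ≤ R.Gfr 0 + 1 := by have := hG 0; linarith
  nlinarith [mul_le_mul_of_nonneg_left h1 hS, abs_nonneg U]

end Summit.HubbardSuperconductivity.HubbardSuperconductivity.Theorems.EngineV8

end
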